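import Mathlib
import HarnessLib
import Summits.ValiantsHypothesis.ValiantsHypothesis.Theorems.LacunarySymmetroidMatrixDescartesProductPlusOneEulerSectors

/-!
# ValiantsHypothesis / LacunarySymmetroid — crux `MatrixDescartes` (stmt-ValiantsHypothesis-18050, V1),
# LINE (A) «product_plus_one», floor `OneChangeFloorK3`: the UNSWITCHED-WINDOW LAW (every support ratio)

Setting of the `K = 3` row at the bottom coupling (✓ `…TameCalculus`, ✓ `…EulerSectors`): factors
`g_j = a_j + b_j x^p + c_j x^q`, `p = e+1`, `q = e+k+2`, and the normalised logarithmic derivative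
`Ψ = Σ_j Ψ_j`, `Ψ_j = (p b_j + q c_j x^{q−p})/g_j` (`(∏ g_j)′ = (∏ g_j)·x^{p−1}·Ψ` off the zeros), whose zeros off the
zeros of the factors are exactly the positive zeros of the line's c-free Euler numerator `eulerNumerator d a 0`.

THE POINT OF THIS FILE.  The numerator of `Ψ_j′` (✓ `hasDerivAt_term`) has the RICCATI FORM (no sign hypothesis, `psi_numerator_eq`)

  `num_j = q(q−p)·x^{q−p−1}·c_j·g_j(x) − x^{p−1}·(p b_j + q c_j x^{q−p})²`,

so `Ψ_j` is strictly decreasing at every `x > 0` where the factor sits OPPOSITE ITS TOP LETTER, `c_j·g_j(x) < 0`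
(`numerator_neg_of_unswitched`) — for EVERY support ratio and every sign pattern: an incoherent no-dip factor `(+,−,−)` BEFORE its
zero (unswitched; the line's T5 «puller»), a coherent factor `(+,+,−)` before its zero, a dip factor `(+,−,+)` INSIDE its dip.
Together with the coherent no-dip factors (`a c < 0 ≤ a b`), which are `Ψ`-decreasing at every ratio in every phase
(`numerator_neg_of_coherent_any`, weight `x^{−p}`; the tree's ✓ `…CoherentSector` uses the weight `x^{−(q−1)}`), and the tame ones
(ratio `≤ 4`, ✓ `numerator_neg`), this gives a POINTWISE, PHASE-DEPENDENT monotonicity criterion (`hasDerivAt_psi_neg_of_rows`) and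

* ★ `euler_window_roots_le_one_of_rows` — on a window `[u,v] ⊂ (0,∞)` on which every factor is, at every point, either opposite its
  top letter, or a non-vanishing coherent no-dip factor, or a non-vanishing no-dip factor at ratio `d 2 − d 0 ≤ 4 (d 1 − d 0)`, the c-free
  Euler numerator `eulerNumerator d a 0` (unfolded) has AT MOST ONE root — ANY support `d 0 < d 1 < d 2`;
* ★ `euler_roots_below_le_one_of_rows` — the same for the initial segment `(0, v]`;
* `top_opposed_of_le` — for an incoherent no-dip factor the condition «opposite its top letter» at `v` propagates to all of `(0, v]`
  (it is monotone in `x`), so ★ `euler_roots_below_le_one_noDip`: in a NO-DIP company of ANY ratio, below the first zero of the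
  coherent factors and while every incoherent factor is unswitched, there is at most ONE critical point.

So above ratio `4` the obstruction to the floor is carried ONLY by SWITCHED incoherent factors (the line's «risers», ✓ `…Riccati`
`drag_nonpos_of_switched`); windows without them are wiggle-free for every ratio and every company of the floor's no-dip types.
HONEST FRAMING: a phase cell of the research floor; NOT `OneChangeFloorK3` / `stub_eulerBoundK3` / `stub_classRowK3` / `stub_polyLaw` /
`MatrixDescartes`; `VP ≠ VNP` is NOT proved.  No definitions, no named facts; Mathlib + the lane files.
-/

set_option linter.dupNamespace false

namespace Summit.ValiantsHypothesis.ValiantsHypothesis.Theorems.LacunarySymmetroidMatrixDescartes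

namespace ProductPlusOne

open Polynomial Finset
open scoped BigOperators

/-! ### §1 The Riccati form of the numerator of `Ψ_j′` -/

/-- **Riccati form** of the numerator of `Ψ_j′` (✓ `hasDerivAt_term`), NO sign hypothesis:
`num = q(q−p)·x^k·(c·g(x)) − x^e·(p b + q c x^{k+1})²` (`p = e+1`, `q = e+k+2`). [folklore] -/
theorem psi_numerator_eq (a b c : ℝ) (e k : ℕ) (x : ℝ) :
    ((e + k + 2 : ℝ) * c * ((k + 1 : ℝ) * x ^ k)) * (a + b * x ^ (e + 1) + c * x ^ (e + k + 2))
        - ((e + 1 : ℝ) * b + (e + k + 2 : ℝ) * c * x ^ (k + 1))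
          * (b * ((e + 1 : ℝ) * x ^ e) + c * ((e + k + 2 : ℝ) * x ^ (e + k + 1)))
      = (e + k + 2 : ℝ) * (k + 1 : ℝ) * x ^ k * (c * (a + b * x ^ (e + 1) + c * x ^ (e + k + 2)))
        - x ^ e * ((e + 1 : ℝ) * b + (e + k + 2 : ℝ) * c * x ^ (k + 1)) ^ 2 := by
  ring

/-! ### §2 Pointwise negativity of the numerator, factor by factor -/

/-- **A factor OPPOSITE ITS TOP LETTER is `Ψ`-decreasing, every ratio, every sign pattern:** `c·g(x) < 0`, `x > 0` ⇒ `num < 0`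
(unswitched incoherent or coherent no-dip factor; a dip factor inside its dip). [this file's lemma] -/
theorem numerator_neg_of_unswitched (a b c : ℝ) (e k : ℕ) {x : ℝ} (hx : 0 < x)
    (hcg : c * (a + b * x ^ (e + 1) + c * x ^ (e + k + 2)) < 0) :
    ((e + k + 2 : ℝ) * c * ((k + 1 : ℝ) * x ^ k)) * (a + b * x ^ (e + 1) + c * x ^ (e + k + 2))
        - ((e + 1 : ℝ) * b + (e + k + 2 : ℝ) * c * x ^ (k + 1))
          * (b * ((e + 1 : ℝ) * x ^ e) + c * ((e + k + 2 : ℝ) * x ^ (e + k + 1))) < 0 := by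
  rw [psi_numerator_eq]
  have h1 : (e + k + 2 : ℝ) * (k + 1 : ℝ) * x ^ k * (c * (a + b * x ^ (e + 1) + c * x ^ (e + k + 2))) < 0 :=
    mul_neg_of_pos_of_neg (by positivity) hcg
  have h2 : 0 ≤ x ^ e * ((e + 1 : ℝ) * b + (e + k + 2 : ℝ) * c * x ^ (k + 1)) ^ 2 := by positivity
  linarith

/-- **A COHERENT no-dip factor is `Ψ`-decreasing at EVERY ratio** (weight `x^{−p}`): `a c < 0`, `a b ≥ 0`, `x > 0` ⇒ `num < 0`.
(Ratio `≤ 4`: ✓ `numerator_neg`; ratio `> 3`: the cross term `q(q−3p)·bc·x^{k+1}` has the sign of `bc ≤ 0`.) [this file's lemma] -/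
theorem numerator_neg_of_coherent_any (a b c : ℝ) (e k : ℕ) (hac : a * c < 0) (hab : 0 ≤ a * b) {x : ℝ} (hx : 0 < x) :
    ((e + k + 2 : ℝ) * c * ((k + 1 : ℝ) * x ^ k)) * (a + b * x ^ (e + 1) + c * x ^ (e + k + 2))
        - ((e + 1 : ℝ) * b + (e + k + 2 : ℝ) * c * x ^ (k + 1))
          * (b * ((e + 1 : ℝ) * x ^ e) + c * ((e + k + 2 : ℝ) * x ^ (e + k + 1))) < 0 := by
  rcases le_or_gt k (3 * e + 2) with hk | hk
  · exact numerator_neg a b c e k hk hac hx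
  · have hbc : b * c ≤ 0 := by
      by_contra hpos
      push Not at hpos
      have h1 : (a * b) * (a * c) ≤ 0 := mul_nonpos_of_nonneg_of_nonpos hab hac.le
      have ha : a ≠ 0 := by
        rintro rfl
        rw [zero_mul] at hac
        exact lt_irrefl 0 hac
      have h2 : 0 < a ^ 2 * (b * c) := mul_pos (by positivity) hpos
      nlinarith
    have hid : ((e + k + 2 : ℝ) * c * ((k + 1 : ℝ) * x ^ k)) * (a + b * x ^ (e + 1) + c * x ^ (e + k + 2))
        - ((e + 1 : ℝ) * b + (e + k + 2 : ℝ) * c * x ^ (k + 1))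
          * (b * ((e + 1 : ℝ) * x ^ e) + c * ((e + k + 2 : ℝ) * x ^ (e + k + 1)))
        = a * c * ((e + k + 2 : ℝ) * (k + 1 : ℝ)) * x ^ k
          + x ^ e * (((e + k + 2 : ℝ) * ((e + k + 2 : ℝ) - 3 * (e + 1 : ℝ)) * x ^ (k + 1)) * (b * c)
            - (e + 1 : ℝ) * (e + k + 2 : ℝ) * c ^ 2 * (x ^ (k + 1)) ^ 2 - (e + 1 : ℝ) ^ 2 * b ^ 2) := by
      ring
    rw [hid]
    have hq3p : 0 ≤ (e + k + 2 : ℝ) - 3 * (e + 1 : ℝ) := by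
      have : (3 * e + 2 : ℝ) < k := by exact_mod_cast hk
      linarith
    have h1 : a * c * ((e + k + 2 : ℝ) * (k + 1 : ℝ)) * x ^ k < 0 :=
      mul_neg_of_neg_of_pos (mul_neg_of_neg_of_pos hac (by positivity)) (pow_pos hx k)
    have hcross : ((e + k + 2 : ℝ) * ((e + k + 2 : ℝ) - 3 * (e + 1 : ℝ)) * x ^ (k + 1)) * (b * c) ≤ 0 :=
      mul_nonpos_of_nonneg_of_nonpos (by positivity) hbc
    have h3 : 0 ≤ (e + 1 : ℝ) * (e + k + 2 : ℝ) * c ^ 2 * (x ^ (k + 1)) ^ 2 := by positivity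
    have h4 : 0 ≤ (e + 1 : ℝ) ^ 2 * b ^ 2 := by positivity
    have h2 : x ^ e * (((e + k + 2 : ℝ) * ((e + k + 2 : ℝ) - 3 * (e + 1 : ℝ)) * x ^ (k + 1)) * (b * c)
            - (e + 1 : ℝ) * (e + k + 2 : ℝ) * c ^ 2 * (x ^ (k + 1)) ^ 2 - (e + 1 : ℝ) ^ 2 * b ^ 2) ≤ 0 :=
      mul_nonpos_of_nonneg_of_nonpos (pow_pos hx e).le (by linarith)
    linarith

/-- **The per-factor criterion** used below: at `x > 0`, a factor is `Ψ`-decreasing if it is opposite its top letter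
(`c·g(x) < 0`), or a no-dip factor (`a c < 0`) that is coherent (`a b ≥ 0`) or tame (`k ≤ 3e+2`, ratio `≤ 4`). [this file's lemma] -/
theorem numerator_neg_of_row (a b c : ℝ) (e k : ℕ) {x : ℝ} (hx : 0 < x)
    (hrow : c * (a + b * x ^ (e + 1) + c * x ^ (e + k + 2)) < 0 ∨ (a * c < 0 ∧ (0 ≤ a * b ∨ k ≤ 3 * e + 2))) :
    ((e + k + 2 : ℝ) * c * ((k + 1 : ℝ) * x ^ k)) * (a + b * x ^ (e + 1) + c * x ^ (e + k + 2))
        - ((e + 1 : ℝ) * b + (e + k + 2 : ℝ) * c * x ^ (k + 1))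
          * (b * ((e + 1 : ℝ) * x ^ e) + c * ((e + k + 2 : ℝ) * x ^ (e + k + 1))) < 0 := by
  rcases hrow with h | ⟨hac, h | h⟩
  · exact numerator_neg_of_unswitched a b c e k hx h
  · exact numerator_neg_of_coherent_any a b c e k hac h hx
  · exact numerator_neg a b c e k h hac hx

/-! ### §3 `Ψ′ < 0` under the pointwise criterion, and Rolle -/

/-- **`Ψ′ < 0` under the per-factor criterion** (`m ≥ 1`, no factor vanishing at `x > 0`). [this file's theorem] -/
theorem hasDerivAt_psi_neg_of_rows {m : ℕ} (hm : 0 < m) (a b c : Fin m → ℝ) (e k : ℕ) {x : ℝ} (hx : 0 < x)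
    (hg : ∀ j, a j + b j * x ^ (e + 1) + c j * x ^ (e + k + 2) ≠ 0)
    (hrow : ∀ j, c j * (a j + b j * x ^ (e + 1) + c j * x ^ (e + k + 2)) < 0 ∨
      (a j * c j < 0 ∧ (0 ≤ a j * b j ∨ k ≤ 3 * e + 2))) :
    ∃ D : ℝ, D < 0 ∧ HasDerivAt (fun y : ℝ => ∑ j, ((e + 1 : ℝ) * b j + (e + k + 2 : ℝ) * c j * y ^ (k + 1))
        / (a j + b j * y ^ (e + 1) + c j * y ^ (e + k + 2))) D x := by
  refine ⟨∑ j, ((((e + k + 2 : ℝ) * c j * ((k + 1 : ℝ) * x ^ k)) * (a j + b j * x ^ (e + 1) + c j * x ^ (e + k + 2))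
        - ((e + 1 : ℝ) * b j + (e + k + 2 : ℝ) * c j * x ^ (k + 1))
          * (b j * ((e + 1 : ℝ) * x ^ e) + c j * ((e + k + 2 : ℝ) * x ^ (e + k + 1))))
        / (a j + b j * x ^ (e + 1) + c j * x ^ (e + k + 2)) ^ 2), ?_, ?_⟩
  · refine Finset.sum_neg (fun j _ => ?_) ⟨⟨0, hm⟩, Finset.mem_univ _⟩
    exact div_neg_of_neg_of_pos (numerator_neg_of_row (a j) (b j) (c j) e k hx (hrow j)) (by have h0 := hg j; positivity)
  · exact HasDerivAt.fun_sum (u := Finset.univ) (fun j _ => hasDerivAt_term (a j) (b j) (c j) e k (hg j))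

/-- **Rolle for `Ψ` under the criterion:** on a window `[w₁,w₂] ⊂ (0,∞)` on which no factor vanishes and every factor meets the
per-factor criterion at every point, `Ψ` does not take the same value twice. [this file's lemma] -/
theorem psi_injective_of_rows {m : ℕ} (hm : 0 < m) (a b c : Fin m → ℝ) (e k : ℕ) {w₁ w₂ : ℝ} (hw₁ : 0 < w₁) (hw : w₁ < w₂)
    (hfree : ∀ t ∈ Set.Icc w₁ w₂, ∀ j, a j + b j * t ^ (e + 1) + c j * t ^ (e + k + 2) ≠ 0)
    (hrow : ∀ t ∈ Set.Icc w₁ w₂, ∀ j, c j * (a j + b j * t ^ (e + 1) + c j * t ^ (e + k + 2)) < 0 ∨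
      (a j * c j < 0 ∧ (0 ≤ a j * b j ∨ k ≤ 3 * e + 2)))
    (heq : (∑ j, ((e + 1 : ℝ) * b j + (e + k + 2 : ℝ) * c j * w₁ ^ (k + 1)) / (a j + b j * w₁ ^ (e + 1) + c j * w₁ ^ (e + k + 2)))
      = ∑ j, ((e + 1 : ℝ) * b j + (e + k + 2 : ℝ) * c j * w₂ ^ (k + 1)) / (a j + b j * w₂ ^ (e + 1) + c j * w₂ ^ (e + k + 2))) :
    False := by
  have hcont : ContinuousOn (fun y : ℝ => ∑ j, ((e + 1 : ℝ) * b j + (e + k + 2 : ℝ) * c j * y ^ (k + 1))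
      / (a j + b j * y ^ (e + 1) + c j * y ^ (e + k + 2))) (Set.Icc w₁ w₂) := by
    intro t ht
    obtain ⟨D, _, hD⟩ := hasDerivAt_psi_neg_of_rows hm a b c e k (hw₁.trans_le ht.1) (hfree t ht) (hrow t ht)
    exact hD.continuousAt.continuousWithinAt
  obtain ⟨ξ, hξ, hξ'⟩ := exists_deriv_eq_zero hw hcont heq
  obtain ⟨D, hDneg, hD⟩ := hasDerivAt_psi_neg_of_rows hm a b c e k (hw₁.trans hξ.1)
    (hfree ξ ⟨hξ.1.le, hξ.2.le⟩) (hrow ξ ⟨hξ.1.le, hξ.2.le⟩)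
  rw [hD.deriv] at hξ'
  exact hDneg.ne hξ'

/-! ### §4 The window law in the normalised chart -/

/-- At `w > 0` with no factor vanishing, `(X·P′)(w) = 0` iff `Ψ(w) = 0` (`P′(w) = P(w)·w^e·Ψ(w)`, ✓ `eval_derivative_prod`). [folklore] -/
theorem psi_eq_zero_of_eval_X_mul_derivative {m : ℕ} (a b c : Fin m → ℝ) (e k : ℕ) {w : ℝ} (hw : 0 < w)
    (hg : ∀ j, a j + b j * w ^ (e + 1) + c j * w ^ (e + k + 2) ≠ 0)
    (h0 : eval w (X * derivative (∏ j, (C (a j) + C (b j) * X ^ (e + 1) + C (c j) * X ^ (e + k + 2)))) = 0) :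
    (∑ j, ((e + 1 : ℝ) * b j + (e + k + 2 : ℝ) * c j * w ^ (k + 1)) / (a j + b j * w ^ (e + 1) + c j * w ^ (e + k + 2))) = 0 := by
  rw [eval_mul, eval_X, eval_derivative_prod a b c e k hg] at h0
  have hP : (∏ j, (a j + b j * w ^ (e + 1) + c j * w ^ (e + k + 2))) ≠ 0 := Finset.prod_ne_zero_iff.mpr (fun j _ => hg j)
  have hwe : w ^ e ≠ 0 := pow_ne_zero _ hw.ne'
  rcases mul_eq_zero.mp h0 with h | h
  · exact absurd h hw.ne'
  · rcases mul_eq_zero.mp h with h' | h'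
    · rcases mul_eq_zero.mp h' with h'' | h''
      · exact absurd h'' hP
      · exact absurd h'' hwe
    · exact h'

/-- **THE WINDOW LAW (normalised chart):** `X·P′` has no two zeros `w₁ < w₂` in `(0,∞)` such that on `[w₁,w₂]` every factor is, at every
point, opposite its top letter (`c_j g_j < 0`) or a non-vanishing coherent/tame no-dip factor. [this file's theorem] -/
theorem X_mul_derivative_no_two_zeros_of_rows {m : ℕ} (hm : 0 < m) (a b c : Fin m → ℝ) (e k : ℕ) {w₁ w₂ : ℝ}
    (hw₁ : 0 < w₁) (hw : w₁ < w₂)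
    (hrow : ∀ t ∈ Set.Icc w₁ w₂, ∀ j, c j * (a j + b j * t ^ (e + 1) + c j * t ^ (e + k + 2)) < 0 ∨
      (a j * c j < 0 ∧ (0 ≤ a j * b j ∨ k ≤ 3 * e + 2) ∧ a j + b j * t ^ (e + 1) + c j * t ^ (e + k + 2) ≠ 0))
    (h1 : eval w₁ (X * derivative (∏ j, (C (a j) + C (b j) * X ^ (e + 1) + C (c j) * X ^ (e + k + 2)))) = 0)
    (h2 : eval w₂ (X * derivative (∏ j, (C (a j) + C (b j) * X ^ (e + 1) + C (c j) * X ^ (e + k + 2)))) = 0) : False := by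
  have hfree : ∀ t ∈ Set.Icc w₁ w₂, ∀ j, a j + b j * t ^ (e + 1) + c j * t ^ (e + k + 2) ≠ 0 := by
    intro t ht j
    rcases hrow t ht j with h | ⟨_, _, h⟩
    · intro h0
      rw [h0, mul_zero] at h
      exact lt_irrefl 0 h
    · exact h
  have hrow' : ∀ t ∈ Set.Icc w₁ w₂, ∀ j, c j * (a j + b j * t ^ (e + 1) + c j * t ^ (e + k + 2)) < 0 ∨
      (a j * c j < 0 ∧ (0 ≤ a j * b j ∨ k ≤ 3 * e + 2)) := by
    intro t ht j
    rcases hrow t ht j with h | ⟨hac, h, _⟩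
    · exact Or.inl h
    · exact Or.inr ⟨hac, h⟩
  exact psi_injective_of_rows hm a b c e k hw₁ hw hfree hrow'
    ((psi_eq_zero_of_eval_X_mul_derivative a b c e k hw₁ (hfree w₁ ⟨le_rfl, hw.le⟩) h1).trans
      (psi_eq_zero_of_eval_X_mul_derivative a b c e k (hw₁.trans hw) (hfree w₂ ⟨hw.le, le_rfl⟩) h2).symm)

/-! ### §5 The window law in the line's currency (`eulerNumerator d a 0`, unfolded) -/

/-- evaluation of a row on the support `d 0, d 0 + e + 1, d 0 + e + k + 2`: `f(t) = t^{d 0}·g(t)`. [folklore] -/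
theorem eval_row_eq_pow_mul (d : Fin 3 → ℕ) (e k : ℕ) (he : d 1 = d 0 + e + 1) (hk : d 2 = d 0 + e + k + 2)
    (a : Fin 3 → ℝ) (t : ℝ) :
    (∑ l, C (a l) * X ^ (d l) : ℝ[X]).eval t = t ^ (d 0) * (a 0 + a 1 * t ^ (e + 1) + a 2 * t ^ (e + k + 2)) := by
  simp only [Fin.sum_univ_three, eval_add, eval_mul, eval_C, eval_pow, eval_X, he, hk]
  ring

/-- ★ **THE UNSWITCHED-WINDOW LAW** (`K = 3`, bottom coupling, ANY support `d 0 < d 1 < d 2`, any `m`).  On a window `[u,v] ⊂ (0,∞)`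
on which, at every point `t`, every row `f_j = Σ_l a_{jl} X^{d_l}` is EITHER opposite its top letter (`a_{j2}·f_j(t) < 0`: an unswitched
incoherent or coherent no-dip row, or a dip row inside its dip) OR a non-vanishing no-dip row (`a_{j0} a_{j2} < 0`, `f_j(t) ≠ 0`) that is
coherent (`a_{j0} a_{j1} ≥ 0`) or tame (`d 2 − d 0 ≤ 4 (d 1 − d 0)`), the c-free Euler numerator `eulerNumerator d a 0` has AT MOST ONE
root. [this file's theorem] -/
theorem euler_window_roots_le_one_of_rows {m : ℕ} (d : Fin 3 → ℕ) (h01 : d 0 < d 1) (h12 : d 1 < d 2)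
    (a : Fin m → Fin 3 → ℝ) {u v : ℝ} (hu : 0 < u)
    (hrow : ∀ t ∈ Set.Icc u v, ∀ j,
      a j 2 * (∑ l, C (a j l) * X ^ (d l) : ℝ[X]).eval t < 0 ∨
      (a j 0 * a j 2 < 0 ∧ (0 ≤ a j 0 * a j 1 ∨ d 2 - d 0 ≤ 4 * (d 1 - d 0)) ∧
        (∑ l, C (a j l) * X ^ (d l) : ℝ[X]).eval t ≠ 0)) :
    ((∑ j, (∑ l, C (a j l * ((d l : ℝ) - d 0)) * X ^ (d l)) * ∏ i ∈ Finset.univ.erase j, (∑ l, C (a i l) * X ^ (d l))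
        : ℝ[X]).roots.toFinset.filter (fun t => u ≤ t ∧ t ≤ v)).card ≤ 1 := by
  classical
  rcases Nat.eq_zero_or_pos m with hm | hm
  · subst hm
    simp only [Finset.univ_eq_empty, Finset.sum_empty, roots_zero, Multiset.toFinset_zero, Finset.filter_empty,
      Finset.card_empty]
    exact Nat.zero_le _
  obtain ⟨e, he⟩ : ∃ e, d 1 = d 0 + e + 1 := ⟨d 1 - d 0 - 1, by omega⟩
  obtain ⟨k, hk⟩ : ∃ k, d 2 = d 0 + e + k + 2 := ⟨d 2 - d 1 - 1, by omega⟩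
  rw [eulerNumerator_eq d e k he hk a 0, sub_self, mul_zero, map_zero, zero_mul, sub_zero]
  set E : ℝ[X] := X * derivative (∏ j, (C (a j 0) + C (a j 1) * X ^ (e + 1) + C (a j 2) * X ^ (e + k + 2))) with hE
  by_contra hgt
  push Not at hgt
  obtain ⟨z₁, hz₁, z₂, hz₂, hne⟩ := Finset.one_lt_card.mp hgt
  -- the row criterion in the normalised chart
  have hrow' : ∀ w₁ w₂ : ℝ, u ≤ w₁ → w₂ ≤ v → ∀ t ∈ Set.Icc w₁ w₂, ∀ j,
      a j 2 * (a j 0 + a j 1 * t ^ (e + 1) + a j 2 * t ^ (e + k + 2)) < 0 ∨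
      (a j 0 * a j 2 < 0 ∧ (0 ≤ a j 0 * a j 1 ∨ k ≤ 3 * e + 2) ∧ a j 0 + a j 1 * t ^ (e + 1) + a j 2 * t ^ (e + k + 2) ≠ 0) := by
    intro w₁ w₂ hw₁ hw₂ t ht j
    have htI : t ∈ Set.Icc u v := ⟨hw₁.trans ht.1, ht.2.trans hw₂⟩
    have ht0 : 0 < t := hu.trans_le htI.1
    have htd : 0 < t ^ (d 0) := pow_pos ht0 _
    rcases hrow t htI j with h | ⟨hac, hct, hne0⟩
    · left
      rw [eval_row_eq_pow_mul d e k he hk (a j) t] at h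
      rw [mul_left_comm] at h
      exact neg_of_mul_neg_right h htd.le
    · right
      refine ⟨hac, ?_, ?_⟩
      · rcases hct with h | h
        · exact Or.inl h
        · right; omega
      · rw [eval_row_eq_pow_mul d e k he hk (a j) t] at hne0
        exact right_ne_zero_of_mul hne0
  -- membership: positive roots of `X^{m d 0} · E` in the window are roots of `E`
  have hmem : ∀ z ∈ (((X : ℝ[X]) ^ (m * d 0) * E).roots.toFinset.filter (fun t => u ≤ t ∧ t ≤ v)),
      u ≤ z ∧ z ≤ v ∧ eval z E = 0 := by
    intro z hz
    rw [mem_filter, Multiset.mem_toFinset] at hz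
    by_cases h0 : (X : ℝ[X]) ^ (m * d 0) * E = 0
    · rw [h0, roots_zero] at hz
      exact absurd hz.1 (Multiset.notMem_zero _)
    · have hr := (mem_roots h0).mp hz.1
      rw [IsRoot.def, eval_mul, eval_pow, eval_X] at hr
      refine ⟨hz.2.1, hz.2.2, ?_⟩
      rcases mul_eq_zero.mp hr with h | h
      · exact absurd h (pow_ne_zero _ (hu.trans_le hz.2.1).ne')
      · exact h
  obtain ⟨hu₁, hv₁, hE₁⟩ := hmem z₁ hz₁
  obtain ⟨hu₂, hv₂, hE₂⟩ := hmem z₂ hz₂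
  rcases lt_or_gt_of_ne hne with hlt | hlt
  · exact X_mul_derivative_no_two_zeros_of_rows hm (fun j => a j 0) (fun j => a j 1) (fun j => a j 2) e k
      (hu.trans_le hu₁) hlt (hrow' z₁ z₂ hu₁ hv₂) hE₁ hE₂
  · exact X_mul_derivative_no_two_zeros_of_rows hm (fun j => a j 0) (fun j => a j 1) (fun j => a j 2) e k
      (hu.trans_le hu₂) hlt (hrow' z₂ z₁ hu₂ hv₁) hE₂ hE₁

/-! ### §6 The initial segment `(0, v]` and the no-dip corollary -/

/-- **Propagation.** If the middle letter does not oppose the top one (`b c ≥ 0`; incoherent no-dip rows `(+,−,−)`, rows `(±,0,∓)`),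
then `c·g(t) = ca + bc·t^p + c²·t^q` is non-decreasing in `t > 0`: «opposite its top letter at `v`» holds on all of `(0, v]`. [folklore] -/
theorem top_opposed_of_le (a b c : ℝ) (e k : ℕ) (hbc : 0 ≤ b * c) {t v : ℝ} (ht : 0 < t) (htv : t ≤ v)
    (hv : c * (a + b * v ^ (e + 1) + c * v ^ (e + k + 2)) < 0) :
    c * (a + b * t ^ (e + 1) + c * t ^ (e + k + 2)) < 0 := by
  have h1 : b * c * t ^ (e + 1) ≤ b * c * v ^ (e + 1) :=
    mul_le_mul_of_nonneg_left (pow_le_pow_left₀ ht.le htv _) hbc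
  have h2 : c * c * t ^ (e + k + 2) ≤ c * c * v ^ (e + k + 2) :=
    mul_le_mul_of_nonneg_left (pow_le_pow_left₀ ht.le htv _) (mul_self_nonneg c)
  have e1 : c * (a + b * t ^ (e + 1) + c * t ^ (e + k + 2)) = c * a + b * c * t ^ (e + 1) + c * c * t ^ (e + k + 2) := by ring
  have e2 : c * (a + b * v ^ (e + 1) + c * v ^ (e + k + 2)) = c * a + b * c * v ^ (e + 1) + c * c * v ^ (e + k + 2) := by ring
  rw [e1]
  rw [e2] at hv
  linarith

/-- ★ **THE UNSWITCHED-WINDOW LAW on an initial segment `(0, v]`:** if at every `t ∈ (0, v]` every row is opposite its top letter or a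
non-vanishing coherent/tame no-dip row, then `eulerNumerator d a 0` has at most ONE root in `(0, v]` (any support). [this file's theorem] -/
theorem euler_roots_below_le_one_of_rows {m : ℕ} (d : Fin 3 → ℕ) (h01 : d 0 < d 1) (h12 : d 1 < d 2)
    (a : Fin m → Fin 3 → ℝ) {v : ℝ}
    (hrow : ∀ t : ℝ, 0 < t → t ≤ v → ∀ j,
      a j 2 * (∑ l, C (a j l) * X ^ (d l) : ℝ[X]).eval t < 0 ∨
      (a j 0 * a j 2 < 0 ∧ (0 ≤ a j 0 * a j 1 ∨ d 2 - d 0 ≤ 4 * (d 1 - d 0)) ∧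
        (∑ l, C (a j l) * X ^ (d l) : ℝ[X]).eval t ≠ 0)) :
    ((∑ j, (∑ l, C (a j l * ((d l : ℝ) - d 0)) * X ^ (d l)) * ∏ i ∈ Finset.univ.erase j, (∑ l, C (a i l) * X ^ (d l))
        : ℝ[X]).roots.toFinset.filter (fun t => 0 < t ∧ t ≤ v)).card ≤ 1 := by
  classical
  set R : ℝ[X] := (∑ j, (∑ l, C (a j l * ((d l : ℝ) - d 0)) * X ^ (d l)) * ∏ i ∈ Finset.univ.erase j, (∑ l, C (a i l) * X ^ (d l))
    : ℝ[X]) with hR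
  by_contra hgt
  push Not at hgt
  obtain ⟨z₁, hz₁, z₂, hz₂, hne⟩ := Finset.one_lt_card.mp hgt
  rw [mem_filter] at hz₁ hz₂
  -- order the two roots
  wlog hlt : z₁ < z₂ generalizing z₁ z₂
  · exact this z₂ hz₂ z₁ hz₁ hne.symm ((lt_or_gt_of_ne hne).resolve_left hlt)
  have hwin := euler_window_roots_le_one_of_rows d h01 h12 a (u := z₁) (v := z₂) hz₁.2.1
    (fun t ht j => hrow t (hz₁.2.1.trans_le ht.1) (ht.2.trans hz₂.2.2) j)
  have htwo : 1 < (R.roots.toFinset.filter (fun t => z₁ ≤ t ∧ t ≤ z₂)).card :=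
    Finset.one_lt_card.mpr ⟨z₁, mem_filter.mpr ⟨hz₁.1, le_rfl, hlt.le⟩, z₂, mem_filter.mpr ⟨hz₂.1, hlt.le, le_rfl⟩, hne⟩
  exact absurd hwin (not_le.mpr htwo)

/-- ★ **NO-DIP COROLLARY (every support ratio).**  A company of no-dip rows (`a_{j0} a_{j2} < 0`: the floor's incoherent `(+,−,−)` and
coherent `(+,+,−)` types, degenerate middle letters allowed), bottom coupling, ANY `d 0 < d 1 < d 2`: if at height `v > 0` every INCOHERENT
row (`a_{j0} a_{j1} < 0`) is still unswitched (`a_{j2}·f_j(v) < 0`) and no COHERENT row (`a_{j0} a_{j1} ≥ 0`) vanishes on `(0, v]`, then the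
c-free Euler numerator `eulerNumerator d a 0` has at most ONE root in `(0, v]` — the product `∏ f_j` has at most one critical point there.
Above ratio `4` only SWITCHED incoherent rows can break the window monotonicity. [this file's theorem] -/
theorem euler_roots_below_le_one_noDip {m : ℕ} (d : Fin 3 → ℕ) (h01 : d 0 < d 1) (h12 : d 1 < d 2)
    (a : Fin m → Fin 3 → ℝ) (hac : ∀ j, a j 0 * a j 2 < 0) {v : ℝ} (hv : 0 < v)
    (hinc : ∀ j, a j 0 * a j 1 < 0 → a j 2 * (∑ l, C (a j l) * X ^ (d l) : ℝ[X]).eval v < 0)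
    (hcoh : ∀ j, 0 ≤ a j 0 * a j 1 → ∀ t : ℝ, 0 < t → t ≤ v → (∑ l, C (a j l) * X ^ (d l) : ℝ[X]).eval t ≠ 0) :
    ((∑ j, (∑ l, C (a j l * ((d l : ℝ) - d 0)) * X ^ (d l)) * ∏ i ∈ Finset.univ.erase j, (∑ l, C (a i l) * X ^ (d l))
        : ℝ[X]).roots.toFinset.filter (fun t => 0 < t ∧ t ≤ v)).card ≤ 1 := by
  obtain ⟨e, he⟩ : ∃ e, d 1 = d 0 + e + 1 := ⟨d 1 - d 0 - 1, by omega⟩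
  obtain ⟨k, hk⟩ : ∃ k, d 2 = d 0 + e + k + 2 := ⟨d 2 - d 1 - 1, by omega⟩
  refine euler_roots_below_le_one_of_rows d h01 h12 a (fun t ht htv j => ?_)
  rcases le_or_gt 0 (a j 0 * a j 1) with hab | hab
  · exact Or.inr ⟨hac j, Or.inl hab, hcoh j hab t ht htv⟩
  · left
    -- the incoherent row is unswitched at `v`, hence at `t ≤ v`
    have h12' : 0 ≤ a j 1 * a j 2 := by
      have ha : a j 0 ≠ 0 := by
        intro h0
        have := hac j
        rw [h0, zero_mul] at this
        exact lt_irrefl 0 this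
      have h1 : 0 < (a j 0 * a j 1) * (a j 0 * a j 2) := mul_pos_of_neg_of_neg hab (hac j)
      by_contra hneg
      push Not at hneg
      have h2 : (a j 0 * a j 1) * (a j 0 * a j 2) = a j 0 ^ 2 * (a j 1 * a j 2) := by ring
      rw [h2] at h1
      have h3 : a j 0 ^ 2 * (a j 1 * a j 2) ≤ 0 := mul_nonpos_of_nonneg_of_nonpos (sq_nonneg _) hneg.le
      linarith
    have hgv : a j 2 * (a j 0 + a j 1 * v ^ (e + 1) + a j 2 * v ^ (e + k + 2)) < 0 := by
      have h := hinc j hab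
      rw [eval_row_eq_pow_mul d e k he hk (a j) v, mul_left_comm] at h
      exact neg_of_mul_neg_right h (pow_pos hv _).le
    have hgt := top_opposed_of_le (a j 0) (a j 1) (a j 2) e k h12' ht htv hgv
    rw [eval_row_eq_pow_mul d e k he hk (a j) t, mul_left_comm]
    exact mul_neg_of_pos_of_neg (pow_pos ht _) hgt

end ProductPlusOne

end Summit.ValiantsHypothesis.ValiantsHypothesis.Theorems.LacunarySymmetroidMatrixDescartes
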